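import Mathlib

/-!
# Crux `HilbertIntegralOverconvergentIsCongruence` (stmt-Langlands-8485), line `Sketch-ideate-r1-k1`,
# section K (Götzky–Koecher): stub `stub_totallyReal_embeddings` (K-D)

Section K of the line proves the Götzky–Koecher principle (Freitag, *Hilbert Modular Forms*, I.4.9)
for Fourier coefficients of `𝓞 F`-periodic functions on `ℂ^{Hom(F,ℝ)}`, computed as cube integrals
in the coordinates `x ↦ (∑ i, x i * σ (b i))_σ` of the integral basis `b = NumberField.integralBasis F`.
This file proves the registered stub `stub_totallyReal_embeddings`, which supplies two standard
number-field facts: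

* (i) for a totally real number field `F`, the sum of `x ∈ F` over the real embeddings
  `σ : F →+* ℝ` equals `Tr_{F/ℚ}(x)`;
* (ii) the "real point" map `ℝ^ι → ℝ^{Hom(F,ℝ)}`, `x ↦ (∑ i, x i * σ (b i))_σ`, is surjective.

Proof.  (i) Mathlib's `trace_eq_sum_embeddings ℂ` (root namespace) gives
`Tr(x) = ∑ σ : F →ₐ[ℚ] ℂ, σ x` in `ℂ`; since every complex embedding of a totally real field is
real (`NumberField.IsTotallyReal.complexEmbedding_isReal`), the map
`σ ↦ (Complex.ofRealHom.comp σ).toRatAlgHom` is a bijection `(F →+* ℝ) → (F →ₐ[ℚ] ℂ)` (inverse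
`ComplexEmbedding.IsReal.embedding`), and we conclude by `Fintype.sum_bijective` and injectivity of
`ℝ → ℂ`.  (ii) Mathlib's `NumberField.mixedEmbedding.latticeBasis F` is an `ℝ`-basis of the mixed
space `ℝ^{r₁} × ℂ^{r₂}` with `latticeBasis F i = mixedEmbedding F (b i)`; given a target
`y : (F →+* ℝ) → ℝ`, expand the vector of the mixed space whose real coordinate at a real place `w`
is `y (embedding_of_isReal w)` in this basis; reading off the real coordinate at the real place of
`Complex.ofRealHom.comp σ` (whose real embedding is `σ`) gives `∑ i, x i * σ (b i) = y σ`.  Part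
(ii) does not use that `F` is totally real.
-/

set_option linter.dupNamespace false -- mandated namespace `Summit.Langlands.Langlands.…` repeats a component

namespace Summit.Langlands.Langlands.Theorems.HilbertIntegralOverconvergentIsCongruence

open NumberField

/-- A real embedding `σ : F →+* ℝ`, followed by `ℝ → ℂ`, is a real complex embedding. -/
theorem kD_isReal_ofRealHom_comp {F : Type} [Field F] (σ : F →+* ℝ) :
    ComplexEmbedding.IsReal (Complex.ofRealHom.comp σ) :=
  ComplexEmbedding.isReal_iff.mpr (RingHom.ext fun x ↦ by
    rw [ComplexEmbedding.conjugate_coe_eq, RingHom.comp_apply, Complex.ofRealHom_eq_coe,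
      Complex.conj_ofReal])

/-- For a totally real number field `F`, `σ ↦ (Complex.ofRealHom.comp σ).toRatAlgHom` is a
bijection from the real embeddings `F →+* ℝ` onto the `ℚ`-algebra embeddings `F →ₐ[ℚ] ℂ`. -/
theorem kD_bijective_toRatAlgHom (F : Type) [Field F] [NumberField F]
    [NumberField.IsTotallyReal F] :
    Function.Bijective (fun σ : F →+* ℝ ↦ (Complex.ofRealHom.comp σ).toRatAlgHom) := by
  refine ⟨fun σ τ h ↦ ?_, fun φ ↦ ?_⟩
  · ext y
    have hy := congrArg (fun ψ : F →ₐ[ℚ] ℂ ↦ (ψ y).re) h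
    simpa using hy
  · have hr := IsTotallyReal.complexEmbedding_isReal (φ : F →+* ℂ)
    refine ⟨hr.embedding, ?_⟩
    ext y
    exact hr.coe_embedding_apply y

/-- **(i)** For a totally real number field `F` and `x ∈ F`, the sum of `σ x` over the real
embeddings `σ : F →+* ℝ` is the trace `Tr_{F/ℚ}(x)` (as a real number). -/
theorem kD_sum_realEmbeddings_eq_trace (F : Type) [Field F] [NumberField F]
    [NumberField.IsTotallyReal F] (x : F) :
    ∑ σ : F →+* ℝ, σ x = algebraMap ℚ ℝ (Algebra.trace ℚ F x) := by
  apply Complex.ofReal_injective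
  have h := trace_eq_sum_embeddings ℂ (K := ℚ) (L := F) (x := x)
  rw [eq_ratCast] at h
  rw [Complex.ofReal_sum, eq_ratCast, Complex.ofReal_ratCast, h]
  exact Fintype.sum_bijective _ (kD_bijective_toRatAlgHom F) _ _ fun σ ↦ rfl

/-- **(ii)** For a number field `F` with integral basis `b = integralBasis F`, the real-point map
`x ↦ (∑ i, x i * σ (b i))_σ` from `ℝ^ι` to `ℝ^{Hom(F,ℝ)}` is surjective (the lattice
`mixedEmbedding (𝓞 F)` has full rank in the mixed space, `mixedEmbedding.latticeBasis`). -/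
theorem kD_realPoint_surjective (F : Type) [Field F] [NumberField F] :
    Function.Surjective (fun x : Module.Free.ChooseBasisIndex ℤ (𝓞 F) → ℝ ↦
      fun σ : F →+* ℝ ↦ ∑ i, x i * σ (integralBasis F i)) := by
  intro y
  -- the real place of the real complex embedding `ℝ ∘ σ`
  let w : (F →+* ℝ) → {w : InfinitePlace F // InfinitePlace.IsReal w} := fun σ ↦
    ⟨InfinitePlace.mk (Complex.ofRealHom.comp σ), ⟨_, kD_isReal_ofRealHom_comp σ, rfl⟩⟩
  -- its real embedding is `σ`
  have hw : ∀ (σ : F →+* ℝ) (a : F), InfinitePlace.embedding_of_isReal (w σ).prop a = σ a := by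
    intro σ a
    apply Complex.ofReal_injective
    rw [InfinitePlace.embedding_of_isReal_apply,
      InfinitePlace.embedding_mk_eq_of_isReal (kD_isReal_ofRealHom_comp σ)]
    rfl
  -- the target vector of the mixed space, expanded in the lattice basis
  let v : mixedEmbedding.mixedSpace F :=
    (fun w' ↦ y (InfinitePlace.embedding_of_isReal w'.prop), 0)
  refine ⟨fun i ↦ (mixedEmbedding.latticeBasis F).repr v i, ?_⟩
  funext σ
  have hsum := congrArg (fun z : mixedEmbedding.mixedSpace F ↦ z.1 (w σ))
    ((mixedEmbedding.latticeBasis F).sum_repr v)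
  simp only [Prod.fst_sum, Finset.sum_apply, Prod.smul_fst, Pi.smul_apply, smul_eq_mul,
    mixedEmbedding.latticeBasis_apply, mixedEmbedding.mixedEmbedding_apply_isReal, hw] at hsum
  change ∑ i, (mixedEmbedding.latticeBasis F).repr v i * σ (integralBasis F i) = y σ
  rw [hsum]
  exact congrArg y (RingHom.ext (hw σ))

/-- **stub K-D — `stub_totallyReal_embeddings`.** Two standard facts about a totally real field
`F`: (i) the sum of `x ∈ F` over the real embeddings is its trace (the real embeddings are all the
complex embeddings, Mathlib `trace_eq_sum_embeddings`); (ii) the real points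
`x ↦ (∑_i x_i σ(b_i))_σ` of the integral basis fill `ℝ^{Hom(F,ℝ)}` (equivalently
`mixedEmbedding.latticeBasis` is a real basis of the mixed space). [folklore] -/
theorem stub_totallyReal_embeddings (F : Type) [Field F] [NumberField F] [NumberField.IsTotallyReal F] :
    (∀ x : F, ∑ σ : F →+* ℝ, σ x = algebraMap ℚ ℝ (Algebra.trace ℚ F x)) ∧
    Function.Surjective (fun x : Module.Free.ChooseBasisIndex ℤ (𝓞 F) → ℝ ↦
      fun σ : F →+* ℝ ↦ ∑ i, x i * σ (integralBasis F i)) :=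
  ⟨kD_sum_realEmbeddings_eq_trace F, kD_realPoint_surjective F⟩

end Summit.Langlands.Langlands.Theorems.HilbertIntegralOverconvergentIsCongruence
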